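import Summits.QuantumFields.BalabanUV.Beta.GAN24.FibreRateTBlockSum

/-!
# `BalabanUV.Beta.GAN24.FibreRateTBlockRatio` — binder row G-an2-4 ∕ (CONV-C), lineage gan24-p3 (part P3, fibre layer), for road FP's X1m-K:
# **THE T-BLOCK RATE OF ROAD P1's PART T AT A FIXED RATIO `R = N∕M`, FOR ANY TWO BLOCKINGS `N ≤ N′`** — the one non-generic input of row L11 generalised
# from the NESTED pair `(N·Lc, N)` vs `(N, M)` (step = ratio) to ANY `(N′, M′)` vs `(N, M)` with `N = M·R`, `N′ = M′·R`, `N ≤ N′`: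
# `‖tSum N′ M′ − tSum N M‖ ≤ tConst R D ∕ N²` (`norm_tSum_ratio_le`), hence for the (j, m)-family (ratio `Lc^m`, step `Lc`):
# `‖tSum (Lc^(j+1+m)) (Lc^(j+1)) − tSum (Lc^(j+m)) (Lc^j)‖ ≤ tConst (Lc^m) D ∕ (Lc^(j+m))²` (`norm_tSum_jm_step_le`)

NOT IN PRINT; OUR PROOF (the proofs are leaf-11-g7's `FibreRateTBlockRate.abs_rf_sq_two_level_le` ∕ `FibreRateTBlockLabel.abs_pFac_two_level_le`,
`norm_xFac_two_level_le`, `norm_tNorm_two_level_le` ∕ `FibreRateTBlockSum.tail_le`, `norm_tSum_two_level_le` RE-RUN with the second system `(N·Lc, N)`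
replaced by a general `(N′, M′)` of the same ratio; every engine lemma — `rf_sq_eq`, `abs_inv_eK_two_level_le_rel`, `abs_inv_ell_two_level_le`,
`abs_inv_sq_ell_two_level_le`, `rf_sq_le_wMaj`, `norm_xFac_le`, `norm_tNorm_le`, `AliasReindex.srep_lift` ∕ `norm_sum_sub_sum_le_of_rates`,
`sum_prod_wMaj_le`, `sq_le_momSq_of_mem_newLabels` — was ALREADY typed for any `N ≤ N′` and is used BY NAME; the ratio = step coincidence of the originals was
notational).  HONEST FRAMING (cell contract, verbatim): «discharging `BetaPertH` makes Bałaban's UV stability UNCONDITIONAL — a real constructive-QFT result;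
it is NOT the continuum limit and NOT the Clay problem.»  HONEST DEPENDENCY (verbatim): «continuum YM on T⁴ ⇐ BetaPertH ∧ nine spine estimates (0/9 proved);
BetaPertH ⇐ (D1) ∧ (D4) ∧ CAP+tail; G-an2-4 gates asym, D1 and NE2/3/4.»

WHY.  `GAN24.PerfectResolventFibre` (this lineage) reduced road FP's X1m-K (convergence of the unit-rescaled (j, m)-resolvents) to the fibre shape
`RealRateKM d Lc m c θ` — road P1's (I2′) at relative blocking `Lc^m`.  Road P1's proof of (I2′) (`FibreRate.realRateK`) feeds `FibreRateLegsD3.ff_rate_of_data`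
with source∕reading data that are typed for ANY `N ≤ N′` of equal ratio, and with ONE two-level input — the T-sum rate `FibreRateTBlockSum.norm_tSum_step_le`
— typed only for the nested pair (step = ratio).  For the (j, m)-family consecutive members are `(N′, M′) = (N·Lc, M·Lc)` at ratio `Lc^m`: step ≠ ratio when
`m ≥ 2`.  This file supplies the T-sum rate at fixed ratio for arbitrary `N ≤ N′` — the located missing piece (census `WOODBURY-FIBRE.md` v8.8 §0).
HONEST: a generalised [folklore] estimate over road P1's objects; by itself it proves NO leg rate and NOTHING of X1m-K ∕ `RealRateKM` (the j-hardwired top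
assembly `FibreRateMF` ∕ `FibreRateLegsD3` ∕ `FibreRateOfLegs` ∕ `FibreRate` at ratio `Lc^m` remains); 0 wall binders; NOT «X1m closed», NEVER «G-an2-4 closed»,
NOT BetaPertH, NOT continuum, NOT Clay.  Pure-number constants are leaf-11's, unchanged (`6`, `280152`, `284148`, `666`, `tConst R D = 284814·coordConst R^D`).

ABSOLUTE RULE (cell, verbatim): «No internally-minted statement may enter as a cited fact. Every hypothesis is either kernel-proved in this package or a
verbatim quotation of a PUBLISHED theorem with page reference.»  Nothing is cited; no `def`; every input is a tree theorem imported BY NAME.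
-/

noncomputable section

open Complex Finset
open scoped BigOperators Real
open Literature.Probability.LatticeModels (TorusSite)
open Literature.MathematicalPhysics.QuantumFieldTheory.King1986 (latticeSymbol momSq momSq_nonneg)
open Literature.MathematicalPhysics.QuantumFieldTheory.Balaban1983to89.B4Strip (ofRealVec)
open Summit.QuantumFields.BalabanUV.Beta.GAN24.AliasReindex
  (srep lift newLabels srep_lift natAbs_srep_le exists_coord_of_mem_newLabels norm_sum_sub_sum_le_of_rates)
open Summit.QuantumFields.BalabanUV.Beta.GAN24.FibreRateTBlock (qlab rf rf_nonneg)
open Summit.QuantumFields.BalabanUV.Beta.GAN24.FibreRateTBlockRate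
open Summit.QuantumFields.BalabanUV.Beta.GAN24.FibreRateTBlockLabel
  (phFac pFac xFac tNorm tNorm_eq norm_phFac pFac_nonneg pFac_le norm_xFac_le sq_mul_norm_num_le qlab_zone norm_tNorm_le)
open Summit.QuantumFields.BalabanUV.Beta.GAN24.FibreRateTBlockSum (coordConst one_le_coordConst sum_prod_wMaj_le sq_le_momSq_of_mem_newLabels tSum tConst)

namespace Summit.QuantumFields.BalabanUV.Beta.GAN24.FibreRateTBlockRatio

variable {D : ℕ}

/-! ## §1 The reading factor and the reading product at fixed ratio, any `N ≤ N′` -/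

section Ratio

variable {N M N' M' R : ℕ}

/-- [folklore] **RATE OF THE SQUARED READING FACTOR AT FIXED RATIO**: for `N = M·R`, `N′ = M′·R`, `N ≤ N′`,
`|rf_{N′,M′}(q)² − rf_{N,M}(q)²| ≤ (6q²/N²)·wMaj R q` on the extended zone of level `N` (`rf_sq_eq`: the numerator `4R² sin²(q/2R)` depends on the ratio only;
`abs_inv_eK_two_level_le_rel` for any `N ≤ N′`). -/
theorem abs_rf_sq_ratio_le (hM : 0 < M) (hM' : 0 < M') (hR : 0 < R) (hNM : N = M * R) (hN'M' : N' = M' * R) (hNN' : N ≤ N')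
    {q : ℝ} (hq : |q| ≤ 5 * π / 3 * (N : ℝ)) :
    |rf N' M' q ^ 2 - rf N M q ^ 2| ≤ 6 * q ^ 2 / (N : ℝ) ^ 2 * wMaj R q := by
  have hN : 0 < N := by rw [hNM]; exact Nat.mul_pos hM hR
  have hN' : (0 : ℝ) < N := by exact_mod_cast hN
  rcases eq_or_ne q 0 with rfl | hq0
  · rw [rf_zero _ _ hM.ne', rf_zero _ _ hM'.ne']; simp
  have hNN'r : (N : ℝ) ≤ (N' : ℝ) := by exact_mod_cast hNN'
  have hq' : |q| ≤ 5 * π / 3 * (N' : ℝ) := zone_mono hNN'r hq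
  have e : ∀ a b c : ℝ, a / b - a / c = a * (b⁻¹ - c⁻¹) := fun a b c => by ring
  rw [rf_sq_eq hM' hR hN'M' hq' hq0, rf_sq_eq hM hR hNM hq hq0, e, abs_mul, abs_of_nonneg (by positivity)]
  have hrel := abs_inv_eK_two_level_le_rel hN' hNN'r hq hq0
  have hw := rf_sq_le_wMaj hM hR hNM hq
  rw [rf_sq_eq hM hR hNM hq hq0] at hw
  calc 4 * (R : ℝ) ^ 2 * Real.sin (q / (2 * R)) ^ 2 * |(eK (N' : ℝ) q)⁻¹ - (eK N q)⁻¹|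
      ≤ 4 * (R : ℝ) ^ 2 * Real.sin (q / (2 * R)) ^ 2 * (6 * q ^ 2 / N ^ 2 * (eK N q)⁻¹) :=
        mul_le_mul_of_nonneg_left hrel (by positivity)
    _ = 6 * q ^ 2 / N ^ 2 * (4 * (R : ℝ) ^ 2 * Real.sin (q / (2 * R)) ^ 2 / eK N q) := by ring
    _ ≤ 6 * q ^ 2 / N ^ 2 * wMaj R q := mul_le_mul_of_nonneg_left hw (by positivity)

/-- [folklore] **RATE OF THE READING PRODUCT AT FIXED RATIO**: `|pFac_{N′,M′}(q) − pFac_{N,M}(q)| ≤ (6·momSq q/N²)·Π_i wMaj R (q_i)`. -/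
theorem abs_pFac_ratio_le (hM : 0 < M) (hM' : 0 < M') (hR : 0 < R) (hNM : N = M * R) (hN'M' : N' = M' * R) (hNN' : N ≤ N')
    {q : Fin D → ℝ} (hq : ∀ i, |q i| ≤ 5 * π / 3 * (N : ℝ)) :
    |pFac N' M' q - pFac N M q| ≤ 6 * momSq q / (N : ℝ) ^ 2 * ∏ i, wMaj R (q i) := by
  classical
  have hNN'r : (N : ℝ) ≤ (N' : ℝ) := by exact_mod_cast hNN'
  have hq' : ∀ i, |q i| ≤ 5 * π / 3 * (N' : ℝ) := fun i => zone_mono hNN'r (hq i)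
  unfold pFac
  have ha : ∀ j ∈ (Finset.univ : Finset (Fin D)), |rf N' M' (q j) ^ 2| ≤ wMaj R (q j) := fun j _ => by
    rw [abs_of_nonneg (sq_nonneg _)]; exact rf_sq_le_wMaj hM' hR hN'M' (hq' j)
  have hb : ∀ j ∈ (Finset.univ : Finset (Fin D)), |rf N M (q j) ^ 2| ≤ wMaj R (q j) := fun j _ => by
    rw [abs_of_nonneg (sq_nonneg _)]; exact rf_sq_le_wMaj hM hR hNM (hq j)
  refine (ReadingWeightRatesSum.abs_prod_sub_prod_le_sum Finset.univ _ _ _ ha hb).trans ?_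
  calc ∑ i, |rf N' M' (q i) ^ 2 - rf N M (q i) ^ 2| * ∏ j ∈ Finset.univ.erase i, wMaj R (q j)
      ≤ ∑ i, (6 * q i ^ 2 / (N : ℝ) ^ 2 * wMaj R (q i)) * ∏ j ∈ Finset.univ.erase i, wMaj R (q j) :=
        Finset.sum_le_sum fun i _ => mul_le_mul_of_nonneg_right (abs_rf_sq_ratio_le hM hM' hR hNM hN'M' hNN' (hq i))
          (Finset.prod_nonneg fun j _ => wMaj_nonneg _ _)
    _ = ∑ i, 6 * q i ^ 2 / (N : ℝ) ^ 2 * ∏ j, wMaj R (q j) := by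
        refine Finset.sum_congr rfl fun i _ => ?_
        rw [mul_assoc, Finset.mul_prod_erase Finset.univ (fun j => wMaj R (q j)) (Finset.mem_univ i)]
    _ = 6 * momSq q / (N : ℝ) ^ 2 * ∏ i, wMaj R (q i) := by
        rw [← Finset.sum_mul]
        congr 1
        rw [momSq, Finset.mul_sum, Finset.sum_div]

/-! ## §2 The bracket at fixed ratio -/

/-- [folklore] **RATE OF THE BRACKET AT FIXED RATIO**: `‖xFac_{N′,M′,R} − xFac_{N,M,R}‖ ≤ 280152/N²` on the extended zone of level `N` (`q ≠ 0`). -/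
theorem norm_xFac_ratio_le (hM : 0 < M) (hM' : 0 < M') (hR : 0 < R) (hNM : N = M * R) (hN'M' : N' = M' * R) (hNN' : N ≤ N')
    {q : Fin D → ℝ} (hq : ∀ i, |q i| ≤ 5 * π / 3 * (N : ℝ)) (hq0 : q ≠ 0) (κ l : Fin D) :
    ‖xFac N' M' R q κ l - xFac N M R q κ l‖ ≤ 280152 / (N : ℝ) ^ 2 := by
  have hN : 0 < N := by rw [hNM]; exact Nat.mul_pos hM hR
  have hN' : (0 : ℝ) < N := by exact_mod_cast hN
  have hNN'r : (N : ℝ) ≤ (N' : ℝ) := by exact_mod_cast hNN'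
  have hq' : ∀ i, |q i| ≤ 5 * π / 3 * (N' : ℝ) := fun i => zone_mono hNN'r (hq i)
  have hl := ell_pos hN' hq hq0
  have hl' := ell_pos (lt_of_lt_of_le hN' hNN'r) hq' hq0
  have hil := inv_ell_le hN' hq hq0
  have hil' := inv_ell_le (lt_of_lt_of_le hN' hNN'r) hq' hq0
  have hm : 0 < momSq q := lt_of_lt_of_le hl (ell_le_momSq hN'.ne' q)
  have hrl := abs_inv_ell_two_level_le hN' hNN'r hq hq0
  have hrl2 := abs_inv_sq_ell_two_level_le hN' hNN'r hq hq0
  have hrr := abs_rf_sq_ratio_le hM hM' hR hNM hN'M' hNN' (hq κ)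
  have hw1 : wMaj R (q κ) ≤ 1 := wMaj_le_one _ _
  have hqκ : q κ ^ 2 ≤ momSq q := Finset.single_le_sum (fun j _ => sq_nonneg (q j)) (Finset.mem_univ κ)
  have hnum := sq_mul_norm_num_le hR q κ l
  set ℓ := latticeSymbol ((N : ℝ)⁻¹) 0 q with hℓ
  set ℓ' := latticeSymbol ((N' : ℝ)⁻¹) 0 q with hℓ'
  set a := cexp (I * ((q κ / R : ℝ) : ℂ)) - 1 with ha
  set b := cexp (-(I * ((q l / R : ℝ) : ℂ))) - 1 with hb
  -- δ-part: real computation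
  have hδ : ‖(if κ = l then (((rf N' M' (q κ)) ^ 2 : ℝ) : ℂ) else 0) / (2 * (ℓ' : ℂ)) -
      (if κ = l then (((rf N M (q κ)) ^ 2 : ℝ) : ℂ) else 0) / (2 * (ℓ : ℂ))‖ ≤ 216 / (N : ℝ) ^ 2 := by
    split_ifs with hκl
    · have e : (((rf N' M' (q κ)) ^ 2 : ℝ) : ℂ) / (2 * (ℓ' : ℂ)) - (((rf N M (q κ)) ^ 2 : ℝ) : ℂ) / (2 * (ℓ : ℂ)) =
          (((rf N' M' (q κ) ^ 2 / (2 * ℓ') - rf N M (q κ) ^ 2 / (2 * ℓ) : ℝ)) : ℂ) := by push_cast; ring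
      rw [e, Complex.norm_real, Real.norm_eq_abs]
      have e2 : rf N' M' (q κ) ^ 2 / (2 * ℓ') - rf N M (q κ) ^ 2 / (2 * ℓ) =
          (rf N' M' (q κ) ^ 2 - rf N M (q κ) ^ 2) * ((1 / 2) * ℓ'⁻¹) + rf N M (q κ) ^ 2 * ((1 / 2) * (ℓ'⁻¹ - ℓ⁻¹)) := by
        field_simp; ring
      rw [e2]
      have hr1 := rf_sq_le_one N M (q κ)
      have h6 : 0 ≤ 6 * q κ ^ 2 / (N : ℝ) ^ 2 * wMaj R (q κ) := by have := wMaj_nonneg R (q κ); positivity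
      have t1 : |(rf N' M' (q κ) ^ 2 - rf N M (q κ) ^ 2) * (1 / 2 * ℓ'⁻¹)| ≤
          (6 * q κ ^ 2 / (N : ℝ) ^ 2 * wMaj R (q κ)) * (1 / 2 * (36 / momSq q)) := by
        rw [abs_mul, abs_of_nonneg (by positivity : (0:ℝ) ≤ 1 / 2 * ℓ'⁻¹)]
        gcongr
      have t2 : |rf N M (q κ) ^ 2 * (1 / 2 * (ℓ'⁻¹ - ℓ⁻¹))| ≤ 1 * (1 / 2 * (216 / (N : ℝ) ^ 2)) := by
        rw [abs_mul, abs_of_nonneg (sq_nonneg _), abs_mul, abs_of_nonneg (by norm_num : (0:ℝ) ≤ 1 / 2)]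
        exact mul_le_mul hr1 (mul_le_mul_of_nonneg_left hrl (by norm_num)) (by positivity) zero_le_one
      refine ((abs_add_le _ _).trans (add_le_add t1 t2)).trans ?_
      have t3 : 6 * q κ ^ 2 / (N : ℝ) ^ 2 * wMaj R (q κ) ≤ 6 * momSq q / (N : ℝ) ^ 2 * 1 :=
        mul_le_mul (by gcongr) hw1 (wMaj_nonneg _ _) (by positivity)
      calc (6 * q κ ^ 2 / (N : ℝ) ^ 2 * wMaj R (q κ)) * (1 / 2 * (36 / momSq q)) + 1 * (1 / 2 * (216 / (N : ℝ) ^ 2))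
          ≤ (6 * momSq q / (N : ℝ) ^ 2 * 1) * (1 / 2 * (36 / momSq q)) + 1 * (1 / 2 * (216 / (N : ℝ) ^ 2)) :=
            add_le_add (mul_le_mul_of_nonneg_right t3 (by positivity : (0:ℝ) ≤ 1 / 2 * (36 / momSq q))) le_rfl
        _ = 216 / (N : ℝ) ^ 2 := by field_simp; ring
    · have h0 : (0 : ℝ) ≤ 216 / (N : ℝ) ^ 2 := by positivity
      calc _ = (0 : ℝ) := by simp
        _ ≤ _ := h0
  -- projector part
  have hP : ‖(R : ℂ) ^ 2 * a * b / (2 * (ℓ' : ℂ) ^ 2) - (R : ℂ) ^ 2 * a * b / (2 * (ℓ : ℂ) ^ 2)‖ ≤ 279936 / (N : ℝ) ^ 2 := by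
    have e : (R : ℂ) ^ 2 * a * b / (2 * (ℓ' : ℂ) ^ 2) - (R : ℂ) ^ 2 * a * b / (2 * (ℓ : ℂ) ^ 2) =
        (R : ℂ) ^ 2 * a * b * (((1 / 2) * ((ℓ' ^ 2)⁻¹ - (ℓ ^ 2)⁻¹) : ℝ) : ℂ) := by
      push_cast; field_simp
    rw [e, Complex.norm_mul, Complex.norm_mul, Complex.norm_mul, Complex.norm_pow, Complex.norm_natCast, Complex.norm_real,
      Real.norm_eq_abs, abs_mul, abs_of_nonneg (by norm_num : (0:ℝ) ≤ 1 / 2), mul_assoc ((R : ℝ) ^ 2)]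
    calc (R : ℝ) ^ 2 * (‖a‖ * ‖b‖) * (1 / 2 * |(ℓ' ^ 2)⁻¹ - (ℓ ^ 2)⁻¹|) ≤ momSq q * (1 / 2 * (559872 / ((N : ℝ) ^ 2 * momSq q))) := by
          gcongr
      _ = 279936 / (N : ℝ) ^ 2 := by field_simp; ring
  unfold xFac
  rw [← hℓ, ← hℓ', ← ha, ← hb]
  have e3 : ∀ (A B C E : ℂ), A - B - (C - E) = (A - C) - (B - E) := fun A B C E => by ring
  rw [e3]
  have e4 : (216 : ℝ) / (N : ℝ) ^ 2 + 279936 / (N : ℝ) ^ 2 = 280152 / (N : ℝ) ^ 2 := by ring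
  exact (norm_sub_le _ _).trans (by linarith)

/-! ## §3 The normalised T-summand and the tail at fixed ratio -/

/-- [folklore] **PER-LABEL RATE AT FIXED RATIO** (matched through `AliasReindex.lift`, the label `q` is THE SAME at both levels):
`‖tNorm_{N′,M′}(lift m) − tNorm_{N,M}(m)‖ ≤ 284148·(Π_i wMaj R (q_i))/N²` for EVERY class `m` of level `N` (the zero label included). -/
theorem norm_tNorm_ratio_le [NeZero N] [NeZero N'] (hN2 : 2 ≤ N) (hM : 0 < M) (hM' : 0 < M') (hR : 0 < R) (hNM : N = M * R)
    (hN'M' : N' = M' * R) (hNN' : N ≤ N') {pr : Fin D → ℝ} (hpr : ∀ i, |pr i| ≤ π) (m : TorusSite D N) (κ l : Fin D) (x' y' : Fin D → ℤ) :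
    ‖tNorm N' M' pr (lift N' m) κ l x' y' - tNorm N M pr m κ l x' y'‖ ≤
      284148 * (∏ i, wMaj R (qlab pr m i)) / (N : ℝ) ^ 2 := by
  have hN : 0 < N := by omega
  have hq := qlab_zone hN2 hpr m
  have hlab : qlab pr (lift N' m) = qlab pr m := by
    funext i; simp only [qlab, srep_lift hNN']
  have hW0 : 0 ≤ ∏ i, wMaj R (qlab pr m i) := Finset.prod_nonneg fun i _ => wMaj_nonneg _ _
  rw [tNorm_eq hR.ne' hM'.ne' hN'M', tNorm_eq hR.ne' hM.ne' hNM, hlab, ← mul_sub, norm_mul, norm_phFac, one_mul]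
  rcases eq_or_ne (qlab pr m) 0 with hq0 | hq0
  · -- the zero label: `ℓ = 0`, both brackets vanish
    have hx : ∀ N'' M'' : ℕ, xFac N'' M'' R (qlab pr m) κ l = 0 := by
      intro N'' M''
      unfold xFac
      have : latticeSymbol ((N'' : ℝ)⁻¹) 0 (qlab pr m) = 0 := by
        rw [hq0]; unfold latticeSymbol; simp [Literature.MathematicalPhysics.QuantumFieldTheory.King1986.fdSymbol]
      rw [this]; simp
    rw [hx, hx]; simp only [mul_zero, sub_self, norm_zero]; positivity
  have hP := abs_pFac_ratio_le hM hM' hR hNM hN'M' hNN' hq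
  have hPb := pFac_le hM hR hNM hq
  have hX := norm_xFac_ratio_le hM hM' hR hNM hN'M' hNN' hq hq0 κ l
  have hNN'r : (N : ℝ) ≤ (N' : ℝ) := by exact_mod_cast hNN'
  have hX'b := norm_xFac_le hM' hR hN'M' (fun i => zone_mono hNN'r (hq i)) hq0 κ l
  have hm : 0 < momSq (qlab pr m) := by
    have hN' : (0:ℝ) < N := by exact_mod_cast hN
    exact lt_of_lt_of_le (ell_pos hN' hq hq0) (ell_le_momSq hN'.ne' _)
  have key := ClosedFormRateOfParts.norm_mul_sub_mul_le (((pFac N M (qlab pr m) : ℝ) : ℂ)) (((pFac N' M' (qlab pr m) : ℝ) : ℂ))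
    (xFac N M R (qlab pr m) κ l) (xFac N' M' R (qlab pr m) κ l)
  rw [← Complex.ofReal_sub, Complex.norm_real, Complex.norm_real, Real.norm_eq_abs, Real.norm_eq_abs,
    abs_of_nonneg (pFac_nonneg _ _ _)] at key
  refine key.trans ?_
  calc |pFac N' M' (qlab pr m) - pFac N M (qlab pr m)| * ‖xFac N' M' R (qlab pr m) κ l‖ +
        pFac N M (qlab pr m) * ‖xFac N' M' R (qlab pr m) κ l - xFac N M R (qlab pr m) κ l‖
      ≤ (6 * momSq (qlab pr m) / (N : ℝ) ^ 2 * ∏ i, wMaj R (qlab pr m i)) * (666 / momSq (qlab pr m)) +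
          (∏ i, wMaj R (qlab pr m i)) * (280152 / (N : ℝ) ^ 2) := by
        gcongr
    _ = 284148 * (∏ i, wMaj R (qlab pr m i)) / (N : ℝ) ^ 2 := by field_simp; ring

/-- [folklore] **THE TAIL AT FIXED RATIO**: `Σ_{m′ ∈ newLabels N N′} ‖tNorm_{N′,M′}(m′)‖ ≤ 666·coordConst R^D/N²` (`N′ = M′·R ≥ N ≥ 2`; new labels have
`momSq ≥ N²`, `FibreRateTBlockSum.sq_le_momSq_of_mem_newLabels`). -/
theorem tail_ratio_le [NeZero N] [NeZero N'] (hN2 : 2 ≤ N) (hM' : 0 < M') (hR : 0 < R) (hN'M' : N' = M' * R) (hNN' : N ≤ N')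
    {pr : Fin D → ℝ} (hpr : ∀ i, |pr i| ≤ π) (κ l : Fin D) (x' y' : Fin D → ℤ) :
    ∑ m' ∈ newLabels N N', ‖tNorm N' M' pr m' κ l x' y'‖ ≤ 666 * coordConst R ^ D / (N : ℝ) ^ 2 := by
  have hN : 0 < N := by omega
  have hN2' : 2 ≤ N' := hN2.trans hNN'
  have hNr : (0 : ℝ) < (N : ℝ) ^ 2 := by positivity
  have hterm : ∀ m' ∈ newLabels N N', ‖tNorm N' M' pr m' κ l x' y'‖ ≤ 666 / (N : ℝ) ^ 2 * ∏ i, wMaj R (qlab pr m' i) := by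
    intro m' hm'
    have hmom := sq_le_momSq_of_mem_newLabels hN2 hpr hm'
    have hq0 : qlab pr m' ≠ 0 := by
      intro h; rw [h] at hmom; simp [momSq] at hmom; nlinarith
    have hb := norm_tNorm_le hN2' hM' hR hN'M' hpr m' hq0 κ l x' y'
    have hW : 0 ≤ ∏ i, wMaj R (qlab pr m' i) := Finset.prod_nonneg fun i _ => wMaj_nonneg _ _
    calc ‖tNorm N' M' pr m' κ l x' y'‖ ≤ 666 * (∏ i, wMaj R (qlab pr m' i)) / momSq (qlab pr m') := hb
      _ ≤ 666 * (∏ i, wMaj R (qlab pr m' i)) / (N : ℝ) ^ 2 := div_le_div_of_nonneg_left (by positivity) hNr hmom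
      _ = 666 / (N : ℝ) ^ 2 * ∏ i, wMaj R (qlab pr m' i) := by ring
  calc ∑ m' ∈ newLabels N N', ‖tNorm N' M' pr m' κ l x' y'‖
      ≤ ∑ m' ∈ newLabels N N', 666 / (N : ℝ) ^ 2 * ∏ i, wMaj R (qlab pr m' i) := Finset.sum_le_sum hterm
    _ ≤ ∑ m' : TorusSite D N', 666 / (N : ℝ) ^ 2 * ∏ i, wMaj R (qlab pr m' i) :=
        Finset.sum_le_sum_of_subset_of_nonneg (Finset.subset_univ _) fun m' _ _ =>
          mul_nonneg (by positivity) (Finset.prod_nonneg fun i _ => wMaj_nonneg _ _)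
    _ = 666 / (N : ℝ) ^ 2 * ∑ m' : TorusSite D N', ∏ i, wMaj R (qlab pr m' i) := by rw [Finset.mul_sum]
    _ ≤ 666 / (N : ℝ) ^ 2 * coordConst R ^ D := mul_le_mul_of_nonneg_left (sum_prod_wMaj_le R N' hpr) (by positivity)
    _ = 666 * coordConst R ^ D / (N : ℝ) ^ 2 := by ring

/-! ## §4 The T-sum at fixed ratio -/

/-- **THE RATE OF THE T-SUM AT FIXED RATIO, ANY TWO BLOCKINGS `N ≤ N′`**: `N = M·R ≥ 2`, `N′ = M′·R`, `M, M′, R ≥ 1`, every real `pr ∈ [−π,π]^D` ⟹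
`‖tSum N′ M′ pr κ l x′ y′ − tSum N M pr κ l x′ y′‖ ≤ tConst R D / N²` (matched labels by §3 + the tail, through `AliasReindex.norm_sum_sub_sum_le_of_rates`).
For `(N′, M′) = (N·R, N)` this is leaf-11's `FibreRateTBlockSum.norm_tSum_two_level_le`. [our object] -/
theorem norm_tSum_ratio_le [NeZero N] [NeZero N'] (hN2 : 2 ≤ N) (hM : 0 < M) (hM' : 0 < M') (hR : 0 < R) (hNM : N = M * R)
    (hN'M' : N' = M' * R) (hNN' : N ≤ N') {pr : Fin D → ℝ} (hpr : ∀ i, |pr i| ≤ π) (κ l : Fin D) (x' y' : Fin D → ℤ) :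
    ‖tSum N' M' pr κ l x' y' - tSum N M pr κ l x' y'‖ ≤ tConst R D / (N : ℝ) ^ 2 := by
  unfold tSum
  have h := norm_sum_sub_sum_le_of_rates hNN' (fun m => tNorm N M pr m κ l x' y') (fun m' => tNorm N' M' pr m' κ l x' y')
    (fun m => 284148 * (∏ i, wMaj R (qlab pr m i)) / (N : ℝ) ^ 2)
    (fun m => norm_tNorm_ratio_le hN2 hM hM' hR hNM hN'M' hNN' hpr m κ l x' y') (tail_ratio_le hN2 hM' hR hN'M' hNN' hpr κ l x' y')
  refine h.trans ?_
  have hS := sum_prod_wMaj_le R N hpr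
  have hc := one_le_coordConst R
  calc ∑ m : TorusSite D N, 284148 * (∏ i, wMaj R (qlab pr m i)) / (N : ℝ) ^ 2 + 666 * coordConst R ^ D / (N : ℝ) ^ 2
      = (284148 * ∑ m : TorusSite D N, ∏ i, wMaj R (qlab pr m i) + 666 * coordConst R ^ D) / (N : ℝ) ^ 2 := by
        rw [Finset.mul_sum, ← Finset.sum_div, add_div]
    _ ≤ (284148 * coordConst R ^ D + 666 * coordConst R ^ D) / (N : ℝ) ^ 2 := by gcongr
    _ = tConst R D / (N : ℝ) ^ 2 := by unfold tConst; ring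

end Ratio

/-! ## §5 The (j, m)-family: ratio `Lc^m`, step `Lc` -/

section JM

variable {Lc : ℕ} [NeZero Lc]

omit [NeZero Lc] in
/-- [folklore] `2 ≤ Lc`, `1 ≤ m` ⟹ `2 ≤ Lc^(j+m)`. -/
theorem two_le_pow_add (hLc2 : 2 ≤ Lc) {m : ℕ} (hm : 1 ≤ m) (j : ℕ) : 2 ≤ Lc ^ (j + m) :=
  hLc2.trans (by
    calc Lc = Lc ^ 1 := (pow_one Lc).symm
      _ ≤ Lc ^ (j + m) := Nat.pow_le_pow_right (by omega) (by omega))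

/-- **THE T-SUM RATE OF THE (j, m)-FAMILY** (`Lc ≥ 2`, `m ≥ 1`, every `j`, real `pr ∈ [−π,π]^D`): consecutive members `(Lc^(j+m), Lc^j)` and
`(Lc^(j+1+m), Lc^(j+1))` — ratio `Lc^m`, step `Lc` — satisfy `‖tSum (Lc^(j+1+m)) (Lc^(j+1)) − tSum (Lc^(j+m)) (Lc^j)‖ ≤ tConst (Lc^m) D / ((Lc^(j+m))²`
(§4 at `R := Lc^m`).  At `m = 1` this is `FibreRateTBlockSum.norm_tSum_step_le`'s shape with the same constant. [our object] -/
theorem norm_tSum_jm_step_le (hLc2 : 2 ≤ Lc) {m : ℕ} (hm : 1 ≤ m) (j : ℕ) {pr : Fin D → ℝ} (hpr : ∀ i, |pr i| ≤ π)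
    (κ l : Fin D) (x' y' : Fin D → ℤ) :
    ‖tSum (Lc ^ (j + 1 + m)) (Lc ^ (j + 1)) pr κ l x' y' - tSum (Lc ^ (j + m)) (Lc ^ j) pr κ l x' y'‖ ≤
      tConst (Lc ^ m) D / ((Lc : ℝ) ^ (j + m)) ^ 2 := by
  have hLc : 0 < Lc := by omega
  have h := norm_tSum_ratio_le (N := Lc ^ (j + m)) (M := Lc ^ j) (N' := Lc ^ (j + 1 + m)) (M' := Lc ^ (j + 1)) (R := Lc ^ m)
    (two_le_pow_add hLc2 hm j) (by positivity) (by positivity) (by positivity) (by rw [← pow_add])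
    (by rw [← pow_add]) (Nat.pow_le_pow_right hLc (by omega)) hpr κ l x' y'
  have hcast : ((Lc ^ (j + m) : ℕ) : ℝ) = (Lc : ℝ) ^ (j + m) := by push_cast; ring
  rw [hcast] at h
  exact h

end JM

end Summit.QuantumFields.BalabanUV.Beta.GAN24.FibreRateTBlockRatio

end
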